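import Literature.Probability.RandomPlanarGeometry.CritPercSLE
import Literature.Probability.RandomPlanarGeometry.SLEMartingale
import Literature.Probability.RandomPlanarGeometry.LoewnerFlow
import HarnessLib

/-!
# Pathwise facts about the SLE_κ Loewner flow (discharges of `CritPercSLE` / `SLEMartingale` facts)

Three named facts about individual sample paths of the SLE_κ Loewner flow
`g_t = sleMap κ ω t = Loewner.map (sleDriving κ ω) t` are proved here from the deterministic
theory of the chordal Loewner equation for *continuous* driving functions
(`LoewnerChainProofs`: maximal solutions, the real flow keeps its side and its order,
`Loewner.swallowingTime_mono_right`, `Loewner.IsSolution.driving_lt_re`, `.re_lt_re`;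
`LoewnerFlow`: `Loewner.map_eq_of_isSolution`), the driving function `sleDriving κ ω = √κ B(ω)`
being continuous for every `ω` (`continuous_sleDriving`):

* `Literature.CritPerc.sleMap_spec_holds κ : CritPerc.sleMap_spec κ` (statement **crit-perc.S19**,
  `CritPercSLE`; Schramm (2000), §1; Lawler (2005), Ch. 4 §4.1, eq. (4.4) with
  `μ_t = 2δ_{U_t}`, and Def. 6.1): for `z ∈ ℍₒ` and `t < T_z`, `s ↦ g_s(z)` has derivative
  `2/(g_t(z) - √κ B_t(ω))` at `t` within `[0, ∞)` and `g_0(z) = z`.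
* `Literature.CritPerc.swallowingStoppingTime_eq_holds : CritPerc.swallowingStoppingTime_eq`
  (`SLEMartingale`; Lawler (2005), Ch. 4 §4.1): for marks `0 < x₀ < x₁ < x₂` the first
  swallowing time of a mark is `T_{x₀}` (real points right of the driving function are swallowed
  in increasing order).
* `Literature.CritPerc.cardyCrossRatio_mem_Ioo_holds : CritPerc.cardyCrossRatio_mem_Ioo`
  (`SLEMartingale`; Lawler (2005), Ch. 4 §4.1; Werner (2007), §3): before that time the flowed
  tuple `W_t < g_t(x₀) < g_t(x₁) < g_t(x₂)` is strictly increasing, so Cardy's cross-ratio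
  `η_t` lies in `(0, 1)` (`crossRatio_mem_Ioo` of `ConformalRectangle`).

## References

* G. F. Lawler, *Conformally Invariant Processes in the Plane*, AMS Math. Surveys 114 (2005),
  Ch. 4 §4.1 (eq. (4.4), the real flow), Def. 6.1.
* O. Schramm, Scaling limits of loop-erased random walks and uniform spanning trees,
  Israel J. Math. 118 (2000), §1.
* W. Werner, Lectures on two-dimensional critical percolation, arXiv:0710.0856 (2007), §3.
-/

noncomputable section

open Set Filter Topology
open UpperHalfPlane (upperHalfPlaneSet)
open scoped NNReal

namespace Literature.Probability.RandomPlanarGeometry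

/-- Discharge of **crit-perc.S19** `CritPerc.sleMap_spec` (the chordal Loewner equation for the
SLE_κ maps, Schramm (2000), §1; Lawler (2005), Ch. 4 §4.1 and Def. 6.1): for every sample path
`ω`, every `z ∈ ℍₒ` and every `t < T_z`, `s ↦ g_s(z) = sleMap κ ω s z` has derivative
`2/(g_t(z) - √κ B_t(ω))` at `t` within `[0, ∞)`, and `g_0(z) = z`. Proof: the driving function
`sleDriving κ ω` is continuous, so the maximal solution `G` of the Loewner equation from `z`
exists (`Loewner.exists_isSolution_swallowingTime_holds`) and `sleMap κ ω s z = G s` for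
`s < T_z` (`Loewner.map_eq_of_isSolution`); the time domain `[0, T_z)` is a neighbourhood of `t`
within `[0, ∞)`. [cite: Lawler2005, Ch. 4 §4.1] -/
theorem sleMap_spec_holds (κ : ℝ≥0) : RandomPlanarGeometry.sleMap_spec κ := by
  intro ω z _ t ht
  have hW : Continuous (sleDriving κ ω) := continuous_sleDriving κ ω
  obtain ⟨G, hG⟩ := Loewner.exists_isSolution_swallowingTime_holds hW
    (Loewner.ne_driving_of_lt_swallowingTime ht)
  have heq : ∀ s : ℝ≥0, (s : WithTop ℝ≥0) < Loewner.swallowingTime (sleDriving κ ω) z →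
      sleMap κ ω s z = G s := fun s hs ↦ Loewner.map_eq_of_isSolution hW hG hs
  have htT : (((t : ℝ)).toNNReal : WithTop ℝ≥0) < Loewner.swallowingTime (sleDriving κ ω) z := by
    rwa [Real.toNNReal_coe]
  refine ⟨?_, ?_⟩
  · have hder : HasDerivWithinAt G (Loewner.vectorField (sleDriving κ ω) t (G t))
        {s : ℝ | 0 ≤ s ∧ (s.toNNReal : WithTop ℝ≥0) < Loewner.swallowingTime (sleDriving κ ω) z}
        t := hG.isIntegralCurveOn t ⟨t.coe_nonneg, htT⟩
    have hnhds : {s : ℝ | 0 ≤ s ∧ (s.toNNReal : WithTop ℝ≥0) <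
        Loewner.swallowingTime (sleDriving κ ω) z} ∈ 𝓝[Ici (0 : ℝ)] (t : ℝ) := by
      have h1 := Loewner.setOf_toNNReal_lt_mem_nhds htT
      have h2 : Ici (0 : ℝ) ∈ 𝓝[Ici (0 : ℝ)] (t : ℝ) := self_mem_nhdsWithin
      filter_upwards [mem_nhdsWithin_of_mem_nhds h1, h2] with s hs hs0
      exact ⟨hs0, hs⟩
    have hder' := hder.mono_of_mem_nhdsWithin hnhds
    have hcongr : ∀ᶠ s in 𝓝[Ici (0 : ℝ)] (t : ℝ), sleMap κ ω s.toNNReal z = G s := by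
      filter_upwards [hnhds] with s hs
      rw [heq s.toNNReal hs.2, Real.coe_toNNReal _ hs.1]
    have hval : sleMap κ ω ((t : ℝ).toNNReal) z = G t := by rw [Real.toNNReal_coe]; exact heq t ht
    have h := hder'.congr_of_eventuallyEq hcongr hval
    rwa [Loewner.vectorField_apply, Real.toNNReal_coe, ← heq t ht] at h
  · have h0 : ((0 : ℝ≥0) : WithTop ℝ≥0) < Loewner.swallowingTime (sleDriving κ ω) z :=
      lt_of_le_of_lt (by simp) ht
    rw [heq 0 h0, NNReal.coe_zero]
    exact hG.apply_zero

/-- Discharge of `CritPerc.swallowingStoppingTime_eq` (`SLEMartingale`): **for marks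
`0 < x₀ < x₁ < x₂` the first swallowing time of a mark is the swallowing time of `x₀`**, for
every sample path: the driving function `√κ B(ω)` is continuous and starts at `0 < x₀ ≤ xᵢ`, and
real points to the right of the driving function are swallowed in increasing order
(`Loewner.swallowingTime_mono_right`, the real flow preserves the order of points on the same
side). Lawler (2005), Ch. 4 §4.1. [cite: Lawler2005, Ch. 4 §4.1] -/
theorem swallowingStoppingTime_eq_holds {κ : ℝ≥0} {x : Fin 3 → ℝ} :
    RandomPlanarGeometry.swallowingStoppingTime_eq (κ := κ) (x := x) := by
  intro hx hx0 ω
  refine le_antisymm (iInf_le _ 0) (le_iInf fun i ↦ ?_)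
  have h0 : sleDriving κ ω 0 < x 0 := by rw [sleDriving_zero]; exact hx0
  exact Loewner.swallowingTime_mono_right (continuous_sleDriving κ ω) h0
    (hx.monotone (Fin.zero_le i))

/-- Discharge of `CritPerc.cardyCrossRatio_mem_Ioo` (`SLEMartingale`): **before the swallowing
time of `x₀`, Cardy's cross-ratio `η_t = crossRatio (W_t, g_t(x₀), g_t(x₁), g_t(x₂))` lies in
`(0, 1)`** for marks `0 < x₀ < x₁ < x₂`, for every sample path. Indeed all three marks are still
flowing at `t` (`t < T = T_{x₀} ≤ T_{xᵢ}`), `g_t(xᵢ) = sleMap κ ω t xᵢ` is the value of the real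
maximal solution from `xᵢ` (`Loewner.map_eq_of_isSolution`), and the real flow keeps the tip to
the left and the order of the marks: `W_t < g_t(x₀)` (`Loewner.IsSolution.driving_lt_re`) and
`g_t(x₀) < g_t(x₁) < g_t(x₂)` (`Loewner.IsSolution.re_lt_re`); a strictly increasing 4-tuple
has cross-ratio in `(0, 1)` (`crossRatio_mem_Ioo`). Lawler (2005), Ch. 4 §4.1; Werner (2007),
§3. [cite: Lawler2005, Ch. 4 §4.1] -/
theorem cardyCrossRatio_mem_Ioo_holds {κ : ℝ≥0} {x : Fin 3 → ℝ} :
    RandomPlanarGeometry.cardyCrossRatio_mem_Ioo (κ := κ) (x := x) := by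
  intro hx hx0 t ω ht
  have hW : Continuous (sleDriving κ ω) := continuous_sleDriving κ ω
  have hW0 : sleDriving κ ω 0 = 0 := sleDriving_zero κ ω
  -- every mark is still flowing at time `t`
  have hti : ∀ i, (t : WithTop ℝ≥0) < Loewner.swallowingTime (sleDriving κ ω) (x i) := fun i ↦
    lt_of_lt_of_le ht (RandomPlanarGeometry.swallowingStoppingTime_le_swallowingTime κ x ω i)
  have hxpos : ∀ i, sleDriving κ ω 0 < x i := fun i ↦ by
    rw [hW0]; exact hx0.trans_le (hx.monotone (Fin.zero_le i))
  -- the real maximal solutions from the marks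
  have hsol : ∀ i, ∃ G : ℝ → ℂ, Loewner.IsSolution (sleDriving κ ω) (x i) G
      (Loewner.swallowingTime (sleDriving κ ω) (x i)) := fun i ↦
    Loewner.exists_isSolution_swallowingTime_holds hW
      (Loewner.ne_driving_of_lt_swallowingTime (hti i))
  choose G hG using hsol
  have hmap : ∀ i, sleMap κ ω t (x i) = G i t := fun i ↦
    Loewner.map_eq_of_isSolution hW (hG i) (hti i)
  have htT : ∀ i, (((t : ℝ)).toNNReal : WithTop ℝ≥0) <
      Loewner.swallowingTime (sleDriving κ ω) (x i) := fun i ↦ by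
    rw [Real.toNNReal_coe]; exact hti i
  -- the flowed tuple is strictly increasing
  have h0 : sleDriving κ ω t < (G 0 t).re := by
    have := (hG 0).driving_lt_re hW (hxpos 0) t.coe_nonneg (htT 0)
    rwa [Real.toNNReal_coe] at this
  have h01 : (G 0 t).re < (G 1 t).re :=
    (hG 0).re_lt_re hW (hG 1) (hxpos 0) (hx (by decide : (0 : Fin 3) < 1)) t.coe_nonneg
      (htT 0) (htT 1)
  have h12 : (G 1 t).re < (G 2 t).re :=
    (hG 1).re_lt_re hW (hG 2) (hxpos 1) (hx (by decide : (1 : Fin 3) < 2)) t.coe_nonneg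
      (htT 1) (htT 2)
  have hmono : StrictMono ![sleDriving κ ω t, (sleMap κ ω t (x 0)).re, (sleMap κ ω t (x 1)).re,
      (sleMap κ ω t (x 2)).re] := by
    rw [hmap 0, hmap 1, hmap 2]
    refine Fin.strictMono_iff_lt_succ.2 fun i ↦ ?_
    fin_cases i
    · simpa using h0
    · simpa using h01
    · simpa using h12
  exact crossRatio_mem_Ioo (Or.inl hmono)

end Literature.Probability.RandomPlanarGeometry
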